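import Summits.QuantumFields.YangMills.Theorems.UnitScaleTiltProp7CurvedLandauKnitT3
import HarnessLib

/-!
# Route `UnitScaleTilt`, crux K1 «MinimiserStabilityRegPr» (stmt-QuantumFields-19200), route-R [RP] curved — THE CURVED LINEAR CORE OF STUB P:
# S2′ (✓ p601741) WITH ALL THREE STRUCTURE ROWS `hA`, `hΛ`, `hE` DISCHARGED for the recursion families of record (d = 3, `SU(2)`):
# `((1∕2)·ℓ⁻² − (18 + 76800L⁴)·δ)·Σ‖Y‖² − (18 + 76800L⁴)·Z − 96·ℓ⁻¹·Z_Q ≤ (18 + 76800L⁴)·Σ‖D_{U₀}Y‖²_HS` under `2·10¹³·L⁹·ε ≤ 1`,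
# modulo ★routeR-w2's curl-lettered `(H¹)^*` row of the coarse gauge function (displayed here in its announced shape; discharged by his `…HLambdaCurl` §3)

Cell `ym3-torus`, keyed width hand `ym-routeR-w3` (D-0154 (3c); row (R1-final), CLAIM 2026-08-28 08:36Z on the cell bus).  Sequel of ✓ `…CurvedLandauKnitT3` (`hA`∕`hE`
discharged).  THEOREMS ONLY (0 `def`, 0 `sorry`); `--supports stmt-QuantumFields-19200`, count-neutral.  YM₃ on T³ is a ladder rung (R3), not the Clay problem; nothing here
claims the stub, the crux, d = 4 or the mass gap.

THE POINT.  ✓ `Prop7CurvedLandauKnitT3.sum_normSq_le_curl_sq_of_divBudget_of_tower_T3` leaves `hΛ : Σ_y‖Λ_{K−n}(y)‖² ≤ c_Λ·ℓ·G₀` displayed.  ★routeR-w2's (R-B)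
chain supplies it for the SAME recursion families in curl∕divergence letters (ANNOUNCE 08:34Z, `…CovIterLambdaHLambdaCurl` §3 `sum_normSq_covIterLambda_le_curl_T3`):
`Σ_y‖Λ_{K−n}(y)‖² ≤ ℓ·(100·N·L⁴·(CURL_HS + DIV_HS) + 10⁹·N²·L⁹·ε·ℓ⁻²·Σ‖Y‖²)` at the non-strict (14)-bound, `2·10⁵L⁵ε ≤ 1`, `300NL²ε ≤ 1`.  §1 takes that row as
the ONE displayed hypothesis `hΛcurl` (its shape at `N = 2`) and closes the arithmetic: `c_Λ := 1`, `G₀ :=` the bracket, the divergence budget `DIV_HS ≤ δΣ‖Y‖² + Z`, and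
`384·4·10⁹·L⁹·ε ≤ 1∕8` under `2·10¹³·L⁹·ε ≤ 1` (which also gives the knit's `10⁶L⁵ε ≤ 1`, `L ≥ 3`).  On the exact Landau slice with the linearised constraint
(`δ = Z = Z_Q = 0`) this is `L^{−2(K−n)}Σ‖Y‖² ≤ 2(18 + 76800L⁴)·Σ‖D_{U₀}Y‖²_HS` — the curved linear core of [Balaban1985Variational] Prop. 7 in kernel letters, uniformly in
`m`, `n`, `K`.  §2 (appended when ★routeR-w2's file lands) discharges `hΛcurl` by `exact`.

WHAT IS PROVED (ns `…Theorems.Prop7CurvedLandauCoreT3`): ★★★ `sum_normSq_le_curl_sq_core_of_hLambdaCurl_T3`.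
HONEST SCOPE.  Arithmetic over the knit; the (R-B) row is DISPLAYED here in ★routeR-w2's announced shape; the pinned ↔ Landau fork (the budget `δ, Z`) and the `Q`-junction
inputs (`Z_Q`, ✓ `…FibreTrueLinDefectMass`) are separate rows.  Nothing of print is asserted beyond the cited tree theorems.

References: T. Bałaban, CMP 99 (1985) 389–434 [Balaban1985BackgroundPropagators] (Thm 3.11 p.416); CMP 102 (1985) 277–309 [Balaban1985Variational] ((14) p.280, Prop. 7 p.299);
CMP 95 (1984) 17–40 [Balaban1984PropagatorsI] ((1.18)–(1.20) pp.19–20).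
-/

set_option autoImplicit false

noncomputable section

open scoped BigOperators Matrix.Norms.L2Operator Matrix

namespace Summit.QuantumFields.YangMills.Theorems.Prop7CurvedLandauCoreT3

open Literature.MathematicalPhysics.QuantumFieldTheory.Balaban1983to89
open Literature.MathematicalPhysics.QuantumFieldTheory.Balaban1983to89.T3ContinuumYM3Torus
open Finset T4Continuum T4ReflectionCone BlockAveraging AveragingRT ExpMeanLog BlockAveragingEMLLinearised BlockAveragingEMLLinearisedBackground
  BlockAveragingEMLProp2 B1RG242Torus
open B15DeterminingSets (embIter)
open B7Prop1Explicit (treeWord)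
open B7Eq78Linearization (conjR)
open B9Eq39Adjoint (curl divB)
open B10Eq27TorusAxialLog (holT unitsField toUField)
open B9TorusCalculus (torusT)
open Summit.QuantumFields.YangMills.Theorems.Prop7CurvedLandauKnitT3 (sum_normSq_le_curl_sq_of_divBudget_of_tower_T3 three_le_L)

/-! ## §1 ★★★ The curved linear core modulo the curl-lettered `(H¹)^*` row -/

/-- ★★★ **THE CURVED LINEAR CORE OF STUB P (d = 3, `SU(2)`), MODULO THE CURL-LETTERED `(H¹)^*` ROW OF THE COARSE GAUGE FUNCTION.**  Background `U₀` with
`dist1(U₀(∂p)) ≤ ε·L^{−2(K−n)}`, `0 < ε`, `2·10¹³·L⁹·ε ≤ 1`; bond field `Y` with `Σ‖D^*_{U₀}Y‖²_HS ≤ δ·Σ‖Y‖² + Z`; the recursion families of record `Q, G, S, Λ` (displayed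
recursions); the true-average constraint budget `Σ_c‖Q^{(K−n)}Y(c)‖² ≤ Z_Q`; and ★routeR-w2's row `hΛcurl` (his `…HLambdaCurl` §3 at `N = 2`).  THEN
`((1∕2)·ℓ⁻² − (18 + 76800L⁴)·δ)·Σ_b‖Y(b)‖² − (18 + 76800L⁴)·Z − 96·ℓ⁻¹·Z_Q ≤ (18 + 76800L⁴)·Σ_{x,μ<ν}‖(D_{U₀}Y)(p_{μν}(x))‖²_HS` (`ℓ = L^{K−n}`).
[cite: Balaban1985BackgroundPropagators, Thm 3.11 p.416; Balaban1985Variational, (14) p.280, Prop. 7 p.299] -/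
theorem sum_normSq_le_curl_sq_core_of_hLambdaCurl_T3 (F : T3Family) (n K : ℕ)
    (U₀ : GaugeField (F.P K) 0 (Matrix.specialUnitaryGroup (Fin 2) ℂ)) {ε : ℝ} (hε : 0 < ε) (hεL : 20000000000000 * (F.L : ℝ) ^ 9 * ε ≤ 1)
    (hU : ∀ p : Plaq (F.P K) 0, dist1 (GaugeField.plaqHol U₀ p) ≤ ε * (((F.L : ℝ) ^ (K - n)) ^ 2)⁻¹)
    (Q : (k : ℕ) → (PBond (F.P K) 0 → Matrix (Fin 2) (Fin 2) ℂ) → PBond (F.P K) k → Matrix (Fin 2) (Fin 2) ℂ) (hQ0 : ∀ Y, Q 0 Y = Y)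
    (hQs : ∀ (k : ℕ) (Y : PBond (F.P K) 0 → Matrix (Fin 2) (Fin 2) ℂ) (c : PBond (F.P K) (k + 1)), Q (k + 1) Y c
      = fderiv ℂ (eml : (Idx (F.P K) → Matrix (Fin 2) (Fin 2) ℂ) → Matrix (Fin 2) (Fin 2) ℂ)
            (fun i => ((loopHol (Averaging.iter (fun i => blockAvg (P := F.P K) (j := i) (expMeanLogSU (n := Fin 2))) k U₀) c i :
              Matrix.specialUnitaryGroup (Fin 2) ℂ) : Matrix (Fin 2) (Fin 2) ℂ))
            (fun i => covWalkSum (Averaging.iter (fun i => blockAvg (P := F.P K) (j := i) (expMeanLogSU (n := Fin 2))) k U₀) (Q k Y)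
                (walk (emb c.src) (loopWord (F.P K).L c.dir (off i.1) i.2.1 i.2.2))
              * ((loopHol (Averaging.iter (fun i => blockAvg (P := F.P K) (j := i) (expMeanLogSU (n := Fin 2))) k U₀) c i :
                Matrix.specialUnitaryGroup (Fin 2) ℂ) : Matrix (Fin 2) (Fin 2) ℂ))
            * star ((corr (expMeanLogSU (n := Fin 2)) (Averaging.iter (fun i => blockAvg (P := F.P K) (j := i) (expMeanLogSU (n := Fin 2))) k U₀) c :
                Matrix.specialUnitaryGroup (Fin 2) ℂ) : Matrix (Fin 2) (Fin 2) ℂ)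
          + ((corr (expMeanLogSU (n := Fin 2)) (Averaging.iter (fun i => blockAvg (P := F.P K) (j := i) (expMeanLogSU (n := Fin 2))) k U₀) c :
                Matrix.specialUnitaryGroup (Fin 2) ℂ) : Matrix (Fin 2) (Fin 2) ℂ)
            * covWalkSum (Averaging.iter (fun i => blockAvg (P := F.P K) (j := i) (expMeanLogSU (n := Fin 2))) k U₀) (Q k Y)
                (walk (emb c.src) (List.replicate (F.P K).L (c.dir, true)))
            * star ((corr (expMeanLogSU (n := Fin 2)) (Averaging.iter (fun i => blockAvg (P := F.P K) (j := i) (expMeanLogSU (n := Fin 2))) k U₀) c :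
                Matrix.specialUnitaryGroup (Fin 2) ℂ) : Matrix (Fin 2) (Fin 2) ℂ))
    (Y : PBond (F.P K) 0 → Matrix (Fin 2) (Fin 2) ℂ)
    (G S : (k : ℕ) → PBond (F.P K) k → Matrix (Fin 2) (Fin 2) ℂ) (Λ : (k : ℕ) → Site (F.P K) k → Matrix (Fin 2) (Fin 2) ℂ)
    (hG0 : ∀ b, G 0 b = Y b) (hS0 : ∀ b, S 0 b = Y b) (hΛ0 : ∀ x, Λ 0 x = 0)
    (hΛs : ∀ (k : ℕ) (z : Site (F.P K) (k + 1)), Λ (k + 1) z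
      = ((Fintype.card (Idx (F.P K)) : ℂ))⁻¹ • ∑ i : Idx (F.P K),
          covWalkSum (Averaging.iter (fun i => blockAvg (P := F.P K) (j := i) (expMeanLogSU (n := Fin 2))) k U₀) (G k)
            (walk (emb z) (stairWord i.2.1 (off i.1)))
        + Λ k (emb z))
    (hGs : ∀ (k : ℕ) (c : PBond (F.P K) (k + 1)), G (k + 1) c
      = (fderiv ℂ (eml : (Idx (F.P K) → Matrix (Fin 2) (Fin 2) ℂ) → Matrix (Fin 2) (Fin 2) ℂ)
            (fun i => ((loopHol (Averaging.iter (fun i => blockAvg (P := F.P K) (j := i) (expMeanLogSU (n := Fin 2))) k U₀) c i :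
              Matrix.specialUnitaryGroup (Fin 2) ℂ) : Matrix (Fin 2) (Fin 2) ℂ))
            (fun i => covWalkSum (Averaging.iter (fun i => blockAvg (P := F.P K) (j := i) (expMeanLogSU (n := Fin 2))) k U₀) (G k)
                (walk (emb c.src) (loopWord (F.P K).L c.dir (off i.1) i.2.1 i.2.2))
              * ((loopHol (Averaging.iter (fun i => blockAvg (P := F.P K) (j := i) (expMeanLogSU (n := Fin 2))) k U₀) c i :
                Matrix.specialUnitaryGroup (Fin 2) ℂ) : Matrix (Fin 2) (Fin 2) ℂ))
            * star ((corr (expMeanLogSU (n := Fin 2)) (Averaging.iter (fun i => blockAvg (P := F.P K) (j := i) (expMeanLogSU (n := Fin 2))) k U₀) c :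
                Matrix.specialUnitaryGroup (Fin 2) ℂ) : Matrix (Fin 2) (Fin 2) ℂ)
          + ((corr (expMeanLogSU (n := Fin 2)) (Averaging.iter (fun i => blockAvg (P := F.P K) (j := i) (expMeanLogSU (n := Fin 2))) k U₀) c :
                Matrix.specialUnitaryGroup (Fin 2) ℂ) : Matrix (Fin 2) (Fin 2) ℂ)
            * covWalkSum (Averaging.iter (fun i => blockAvg (P := F.P K) (j := i) (expMeanLogSU (n := Fin 2))) k U₀) (G k)
                (walk (emb c.src) (List.replicate (F.P K).L (c.dir, true)))
            * star ((corr (expMeanLogSU (n := Fin 2)) (Averaging.iter (fun i => blockAvg (P := F.P K) (j := i) (expMeanLogSU (n := Fin 2))) k U₀) c :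
                Matrix.specialUnitaryGroup (Fin 2) ℂ) : Matrix (Fin 2) (Fin 2) ℂ))
        - ((((Fintype.card (Idx (F.P K)) : ℂ))⁻¹ • ∑ i : Idx (F.P K),
              covWalkSum (Averaging.iter (fun i => blockAvg (P := F.P K) (j := i) (expMeanLogSU (n := Fin 2))) k U₀) (G k) (walk (emb c.src) (stairWord i.2.1 (off i.1))))
            - ((Averaging.iter (fun i => blockAvg (P := F.P K) (j := i) (expMeanLogSU (n := Fin 2))) (k + 1) U₀ c : Matrix.specialUnitaryGroup (Fin 2) ℂ) :
                Matrix (Fin 2) (Fin 2) ℂ)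
              * (((Fintype.card (Idx (F.P K)) : ℂ))⁻¹ • ∑ i : Idx (F.P K),
                  covWalkSum (Averaging.iter (fun i => blockAvg (P := F.P K) (j := i) (expMeanLogSU (n := Fin 2))) k U₀) (G k) (walk (emb c.tgt) (stairWord i.2.1 (off i.1))))
              * star ((Averaging.iter (fun i => blockAvg (P := F.P K) (j := i) (expMeanLogSU (n := Fin 2))) (k + 1) U₀ c :
                Matrix.specialUnitaryGroup (Fin 2) ℂ) : Matrix (Fin 2) (Fin 2) ℂ)))
    (hSs : ∀ (k : ℕ) (c : PBond (F.P K) (k + 1)), S (k + 1) c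
      = ((Fintype.card (Idx (F.P K)) : ℂ))⁻¹ • ∑ i : Idx (F.P K),
          ((holAt (Averaging.iter (fun i => blockAvg (P := F.P K) (j := i) (expMeanLogSU (n := Fin 2))) k U₀) (walk (emb c.src) (stairWord i.2.1 (off i.1))) :
              Matrix.specialUnitaryGroup (Fin 2) ℂ) : Matrix (Fin 2) (Fin 2) ℂ) *
            covWalkSum (Averaging.iter (fun i => blockAvg (P := F.P K) (j := i) (expMeanLogSU (n := Fin 2))) k U₀) (S k)
              (walk (walkEnd (emb c.src) (stairWord i.2.1 (off i.1))) (List.replicate (F.P K).L (c.dir, true))) *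
          star ((holAt (Averaging.iter (fun i => blockAvg (P := F.P K) (j := i) (expMeanLogSU (n := Fin 2))) k U₀) (walk (emb c.src) (stairWord i.2.1 (off i.1))) :
              Matrix.specialUnitaryGroup (Fin 2) ℂ) : Matrix (Fin 2) (Fin 2) ℂ))
    {δ Z : ℝ}
    (hdivB : (∑ x : Site (F.P K) 0, ∑ j : Fin 2, ∑ k : Fin 2,
            ‖(divB (torusT (F.P K) 0) (fun κ z => unitsField (toUField U₀) ⟨z, κ⟩) (fun κ z => Y ⟨z, κ⟩) x) j k‖ ^ 2)
      ≤ δ * (∑ b : PBond (F.P K) 0, ‖Y b‖ ^ 2) + Z)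
    {ZQ : ℝ} (hQ : ∑ c : PBond (F.P K) (K - n), ‖Q (K - n) Y c‖ ^ 2 ≤ ZQ)
    (hΛcurl : ∑ y : Site (F.P K) (K - n), ‖Λ (K - n) y‖ ^ 2
      ≤ ((F.L : ℝ) ^ (K - n)) * (100 * (2 : ℝ) * (F.L : ℝ) ^ 4 * ((∑ x : Site (F.P K) 0, ∑ μ : Fin (F.P K).d, ∑ ν : Fin (F.P K).d,
            (if μ < ν then ∑ j : Fin 2, ∑ k : Fin 2,
              ‖(curl (torusT (F.P K) 0) (fun κ z => unitsField (toUField U₀) ⟨z, κ⟩) (fun κ z => Y ⟨z, κ⟩) μ ν x) j k‖ ^ 2 else 0))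
          + (∑ x : Site (F.P K) 0, ∑ j : Fin 2, ∑ k : Fin 2,
            ‖(divB (torusT (F.P K) 0) (fun κ z => unitsField (toUField U₀) ⟨z, κ⟩) (fun κ z => Y ⟨z, κ⟩) x) j k‖ ^ 2))
        + 1000000000 * (2 : ℝ) ^ 2 * (F.L : ℝ) ^ 9 * ε * (((F.L : ℝ) ^ (K - n)) ^ 2)⁻¹ * (∑ b : PBond (F.P K) 0, ‖Y b‖ ^ 2))) :
    ((1 / 2) * (((F.L : ℝ) ^ (K - n)) ^ 2)⁻¹ - (18 + 76800 * (F.L : ℝ) ^ 4) * δ) * (∑ b : PBond (F.P K) 0, ‖Y b‖ ^ 2) - (18 + 76800 * (F.L : ℝ) ^ 4) * Z - 96 * ((F.L : ℝ) ^ (K - n))⁻¹ * ZQ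
      ≤ (18 + 76800 * (F.L : ℝ) ^ 4) * (∑ x : Site (F.P K) 0, ∑ μ : Fin (F.P K).d, ∑ ν : Fin (F.P K).d,
            (if μ < ν then ∑ j : Fin 2, ∑ k : Fin 2,
              ‖(curl (torusT (F.P K) 0) (fun κ z => unitsField (toUField U₀) ⟨z, κ⟩) (fun κ z => Y ⟨z, κ⟩) μ ν x) j k‖ ^ 2 else 0)) := by
  have hL3 := three_le_L F
  have hLpos : (0 : ℝ) < (F.L : ℝ) := by linarith
  have hℓ : (0 : ℝ) < ((F.L : ℝ) ^ (K - n)) := pow_pos hLpos _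
  -- the knit's numeral `10⁶L⁵ε ≤ 1` from `2·10¹³L⁹ε ≤ 1`, `L ≥ 3`
  have hL1 : (1 : ℝ) ≤ (F.L : ℝ) := by linarith
  have hεL6 : 1000000 * (F.L : ℝ) ^ 5 * ε ≤ 1 := by
    have h1 : (F.L : ℝ) ^ 5 ≤ (F.L : ℝ) ^ 9 := pow_le_pow_right₀ hL1 (by norm_num)
    nlinarith [h1, hε.le]
  -- the knit with `cΛ := 1`, `G₀ :=` ★routeR-w2's bracket
  have hΛ : ∑ y : Site (F.P K) (K - n), ‖Λ (K - n) y‖ ^ 2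
      ≤ 1 * ((F.L : ℝ) ^ (K - n)) * (100 * (2 : ℝ) * (F.L : ℝ) ^ 4 * ((∑ x : Site (F.P K) 0, ∑ μ : Fin (F.P K).d, ∑ ν : Fin (F.P K).d,
            (if μ < ν then ∑ j : Fin 2, ∑ k : Fin 2,
              ‖(curl (torusT (F.P K) 0) (fun κ z => unitsField (toUField U₀) ⟨z, κ⟩) (fun κ z => Y ⟨z, κ⟩) μ ν x) j k‖ ^ 2 else 0))
          + (∑ x : Site (F.P K) 0, ∑ j : Fin 2, ∑ k : Fin 2,
            ‖(divB (torusT (F.P K) 0) (fun κ z => unitsField (toUField U₀) ⟨z, κ⟩) (fun κ z => Y ⟨z, κ⟩) x) j k‖ ^ 2))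
        + 1000000000 * (2 : ℝ) ^ 2 * (F.L : ℝ) ^ 9 * ε * (((F.L : ℝ) ^ (K - n)) ^ 2)⁻¹ * (∑ b : PBond (F.P K) 0, ‖Y b‖ ^ 2)) := by rw [one_mul]; exact hΛcurl
  have hknit := sum_normSq_le_curl_sq_of_divBudget_of_tower_T3 F n K U₀ hε hεL6 hU Q hQ0 hQs Y G S Λ hG0 hS0 hΛ0 hΛs hGs hSs hdivB hΛ hQ
  -- scalar bookkeeping
  have hSY : 0 ≤ (∑ b : PBond (F.P K) 0, ‖Y b‖ ^ 2) := Finset.sum_nonneg fun _ _ => sq_nonneg _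
  have hCURL : 0 ≤ (∑ x : Site (F.P K) 0, ∑ μ : Fin (F.P K).d, ∑ ν : Fin (F.P K).d,
            (if μ < ν then ∑ j : Fin 2, ∑ k : Fin 2,
              ‖(curl (torusT (F.P K) 0) (fun κ z => unitsField (toUField U₀) ⟨z, κ⟩) (fun κ z => Y ⟨z, κ⟩) μ ν x) j k‖ ^ 2 else 0)) := by
    refine Finset.sum_nonneg fun _ _ => Finset.sum_nonneg fun _ _ => Finset.sum_nonneg fun _ _ => ?_
    split_ifs
    · exact Finset.sum_nonneg fun _ _ => Finset.sum_nonneg fun _ _ => sq_nonneg _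
    · exact le_rfl
  have hmass : 384 * (1000000000 * (2 : ℝ) ^ 2 * (F.L : ℝ) ^ 9 * ε) ≤ 1 / 8 := by nlinarith [hε.le]
  have hw0 : 0 ≤ (((F.L : ℝ) ^ (K - n)) ^ 2)⁻¹ * (∑ b : PBond (F.P K) 0, ‖Y b‖ ^ 2) := by positivity
  have hmass' : 384 * (1 * (1000000000 * (2 : ℝ) ^ 2 * (F.L : ℝ) ^ 9 * ε * (((F.L : ℝ) ^ (K - n)) ^ 2)⁻¹ * (∑ b : PBond (F.P K) 0, ‖Y b‖ ^ 2))) ≤ (1 / 8) * ((((F.L : ℝ) ^ (K - n)) ^ 2)⁻¹ * (∑ b : PBond (F.P K) 0, ‖Y b‖ ^ 2)) := by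
    have := mul_le_mul_of_nonneg_right hmass hw0
    linarith [this]
  have hL4 : 0 ≤ (F.L : ℝ) ^ 4 := by positivity
  have hdiv' := mul_le_mul_of_nonneg_left hdivB (by positivity : (0 : ℝ) ≤ 384 * (1 * (100 * (2 : ℝ) * (F.L : ℝ) ^ 4)))
  linarith only [hknit, hmass', hdiv', hCURL, hL4, hSY]

end Summit.QuantumFields.YangMills.Theorems.Prop7CurvedLandauCoreT3

end
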